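import Mathlib
import Summits.ResolutionOfSingularities.ResolutionOfSingularities.Theorems.WeightedInvariantELadderOneTrivialEndRing
import HarnessLib

/-!
# The trivial end of the cobordism over the LOCAL RING: `𝒪_{B₊,y'}` as a localisation of `𝒪_{Y,y}[X]` (ring level)

Route `ResolutionOfSingularities/WeightedInvariant`, crux `Theses.WeightedInvariant.HypersurfaceCentreConstruction`
(stmt-ResolutionOfSingularities-19897), door line `local-engine`, E2 tier, piece (S-a) `E2StepOffBody` of the registered stub
`stub_e2_step_h` (res-L1-w43-plan-1 SPEC (Δ6), OFFER (o59-a)); ring-level half, consumed by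
`Theorems/WeightedInvariantELadderTwoStepOff.lean`.

For the extended Rees algebra `S = A[t⁻¹, Jₙ tⁿ] ⊆ A[t, t⁻¹]` of an ideal filtration on `A` and a prime `Q ∌ t⁻¹` of `S`
(a point of the trivial end `B₋ = B ∖ V(t⁻¹) = Y × 𝔾ₘ`, Włodarczyk Def. 2.3.5):
* `isLocalization_atPrime_comap_aeval` — `S_Q` is the localisation of the POLYNOMIAL ring `A[X]` (`X ↦ t⁻¹`) at `Q ∩ A[X]`
  (the instance built inside res-D-pv-023's `isRegularLocalRing_localization_quotient_saturation`, extracted as a theorem);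
* **`exists_offCentre_polynomial_model`** — for `p = Q ∩ A`, a localisation `O` of `A` at `p` (model of `𝒪_{Y,y}`), a
  localisation `T'` of `S` at `Q` (model of `𝒪_{B₊,y'}`) and THE map `ℓ : O → T'` over `A → S` (`σ₊^♯`): `T'` is the localisation of
  `O[X]` at a prime `𝔮` with `𝔮 ∩ O = 𝔪_O`, by an isomorphism `e : O[X]_𝔮 ≃+* T'` with `e (C s / 1) = ℓ s` — the data of
  `Stage.SuccOffCentreAt` (…ELadderTwoCompatible) at ring level (`Polynomial.isLocalization`: `O[X] = (A ∖ p)⁻¹ A[X]`;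
  `IsLocalization.isLocalization_of_submonoid_le` + `IsLocalization.of_le` along `A ∖ p ⊆ A[X] ∖ (Q ∩ A[X])`; compatibility by
  `eval₂` on constants).
Def-free; OURS bookkeeping; nothing here is a claim about Hironaka's problem; AI-written, weaker than expert review.
[cite: Wlodarczyk2022, Def. 2.3.5 and 3.3.12]
-/

noncomputable section

set_option linter.dupNamespace false -- mandated namespace of this single-conjunct summit

open scoped LaurentPolynomial Polynomial
open LaurentPolynomial Polynomial IsLocalRing
open Literature.AlgebraicGeometry.Resolution

namespace Summit.ResolutionOfSingularities.ResolutionOfSingularities.Theorems.ELadderOne.TrivialEnd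

universe u v w

section ExtendedRees

variable {A : Type u} [CommRing A] (F : IdealFiltration A)
  (t : F.extendedRees) (ht : (t : A[T;T⁻¹]) = T (-1))

include ht in
/-- **`S_Q` is a localisation of `A[X]` (`X ↦ t⁻¹`) at `Q ∩ A[X]`** for a prime `Q ∌ t⁻¹` of the extended Rees algebra
`S = A[t⁻¹, Jₙ tⁿ]` (the ring-level trivial end; extracted from the proof of
`isRegularLocalRing_localization_quotient_saturation`, res-D-pv-023). The `A[X]`-algebra structure on `Sq` is the one
through `aeval t`. [cite: Wlodarczyk2022, Def. 2.3.5] -/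
theorem isLocalization_atPrime_comap_aeval (Q : Ideal F.extendedRees) [Q.IsPrime] (htQ : t ∉ Q)
    (Sq : Type v) [CommRing Sq] [Algebra F.extendedRees Sq] [IsLocalization.AtPrime Sq Q] :
    @IsLocalization.AtPrime _ _ Sq _
      (((algebraMap F.extendedRees Sq).comp
        ((aeval t : A[X] →ₐ[A] F.extendedRees) : A[X] →+* F.extendedRees)).toAlgebra)
      (Q.comap ((aeval t : A[X] →ₐ[A] F.extendedRees) : A[X] →+* F.extendedRees)) _ := by
  letI alg : Algebra A[X] Sq :=
    ((algebraMap F.extendedRees Sq).comp ((aeval t : A[X] →ₐ[A] F.extendedRees) : A[X] →+* F.extendedRees)).toAlgebra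
  set 𝔔 : Ideal A[X] := Q.comap ((aeval t : A[X] →ₐ[A] F.extendedRees) : A[X] →+* F.extendedRees) with h𝔔
  have hmem𝔔 : ∀ f : A[X], f ∈ 𝔔 ↔ aeval t f ∈ Q := fun f => by rw [h𝔔]; exact Iff.rfl
  have halg : ∀ f : A[X], algebraMap A[X] Sq f = algebraMap F.extendedRees Sq (aeval t f) := fun _ => rfl
  refine (isLocalization_iff 𝔔.primeCompl Sq).mpr ⟨?_, ?_, ?_⟩
  · rintro ⟨y, hy⟩
    rw [halg]
    exact IsLocalization.map_units Sq (⟨aeval t y, fun h => hy ((hmem𝔔 y).mpr h)⟩ : Q.primeCompl)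
  · intro z
    obtain ⟨⟨s, u⟩, hz⟩ := IsLocalization.surj Q.primeCompl z
    obtain ⟨n₁, f₁, h₁⟩ := exists_pow_mul_eq_aeval F t ht s
    obtain ⟨n₂, f₂, h₂⟩ := exists_pow_mul_eq_aeval F t ht (u : F.extendedRees)
    have hψg : aeval t (f₂ * X ^ n₁) = (u : F.extendedRees) * t ^ (n₁ + n₂) := by
      rw [map_mul, map_pow, aeval_X, ← h₂]; ring
    have hψf : aeval t (f₁ * X ^ n₂) = s * t ^ (n₁ + n₂) := by
      rw [map_mul, map_pow, aeval_X, ← h₁]; ring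
    have hg : f₂ * X ^ n₁ ∉ 𝔔 := by
      rw [hmem𝔔, hψg]
      exact Q.primeCompl.mul_mem u.2 (Q.primeCompl.pow_mem (show t ∈ Q.primeCompl from htQ) _)
    refine ⟨⟨f₁ * X ^ n₂, ⟨f₂ * X ^ n₁, hg⟩⟩, ?_⟩
    change z * algebraMap F.extendedRees Sq (aeval t (f₂ * X ^ n₁)) =
      algebraMap F.extendedRees Sq (aeval t (f₁ * X ^ n₂))
    simp only [hψg, hψf, map_mul, ← mul_assoc, hz]
  · intro f g hfg
    rw [halg, halg] at hfg
    obtain ⟨⟨c, hc⟩, hcfg⟩ := IsLocalization.exists_of_eq (M := Q.primeCompl) hfg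
    obtain ⟨n, h, hh⟩ := exists_pow_mul_eq_aeval F t ht c
    have hh𝔔 : h ∉ 𝔔 := by
      rw [hmem𝔔, ← hh]
      exact Q.primeCompl.mul_mem (Q.primeCompl.pow_mem (show t ∈ Q.primeCompl from htQ) n) hc
    refine ⟨⟨h, hh𝔔⟩, aeval_injective F t ht ?_⟩
    change aeval t (h * f) = aeval t (h * g)
    simp only at hcfg
    rw [map_mul, map_mul, ← hh, mul_assoc, mul_assoc, hcfg]

include ht in
/-- **THE TORUS-FACTOR MODEL OVER THE LOCAL RING (trivial end, ring level).**  `S = A[t⁻¹, Jₙ tⁿ]`, `Q ∌ t⁻¹` a prime of `S`,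
`p = Q ∩ A`, `O` a localisation of `A` at `p` (a model of `𝒪_{Y,y}`), `T'` a localisation of `S` at `Q` (a model of
`𝒪_{B₊,y'}`), and `ℓ : O → T'` THE map over `A → S` (`σ₊^♯`).  Then `T'` is the localisation of the polynomial ring `O[X]` at a
prime `𝔮` over `𝔪_O`, compatibly with `ℓ` on constants: `O[X] = A_p[X]` is `A[X]` localised at `A ∖ p`, `T' = A[X]_{Q ∩ A[X]}`
(`isLocalization_atPrime_comap_aeval`), and `A ∖ p ⊆ A[X] ∖ (Q ∩ A[X])`. [cite: Wlodarczyk2022, Def. 2.3.5] -/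
theorem exists_offCentre_polynomial_model (Q : Ideal F.extendedRees) [Q.IsPrime] (htQ : t ∉ Q)
    {p : Ideal A} [p.IsPrime] (hp : Q.comap (algebraMap A F.extendedRees) = p)
    (O : Type v) [CommRing O] [IsLocalRing O] [Algebra A O] [IsLocalization.AtPrime O p]
    (T' : Type w) [CommRing T'] [Algebra F.extendedRees T'] [IsLocalization.AtPrime T' Q]
    (ℓ : O →+* T')
    (hℓ : ∀ a : A, ℓ (algebraMap A O a) = algebraMap F.extendedRees T' (algebraMap A F.extendedRees a)) :
    ∃ (𝔮 : Ideal O[X]) (_ : 𝔮.IsPrime),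
      𝔮.comap (C : O →+* O[X]) = maximalIdeal O ∧
      ∃ e : Localization.AtPrime 𝔮 ≃+* T',
        ∀ s : O, e (algebraMap O[X] (Localization.AtPrime 𝔮) (C s)) = ℓ s := by
  -- `T'` over `A[X]` through `aeval t`
  letI algT : Algebra A[X] T' :=
    ((algebraMap F.extendedRees T').comp ((aeval t : A[X] →ₐ[A] F.extendedRees) : A[X] →+* F.extendedRees)).toAlgebra
  have halgT : ∀ f : A[X], algebraMap A[X] T' f = algebraMap F.extendedRees T' (aeval t f) := fun _ => rfl
  set 𝔔 : Ideal A[X] := Q.comap ((aeval t : A[X] →ₐ[A] F.extendedRees) : A[X] →+* F.extendedRees) with h𝔔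
  have hmem𝔔 : ∀ f : A[X], f ∈ 𝔔 ↔ aeval t f ∈ Q := fun f => by rw [h𝔔]; exact Iff.rfl
  haveI h𝔔p : 𝔔.IsPrime := Ideal.IsPrime.comap _
  haveI hT : IsLocalization.AtPrime T' 𝔔 := isLocalization_atPrime_comap_aeval F t ht Q htQ T'
  -- `O[X]` over `A[X]`: the localisation at `(A ∖ p) ⊆ A[X]`
  letI algO : Algebra A[X] O[X] := Polynomial.algebra A O
  haveI hO : IsLocalization (p.primeCompl.map (C : A →+* A[X])) O[X] := Polynomial.isLocalization p.primeCompl O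
  have halgO : ∀ f : A[X], algebraMap A[X] O[X] f = Polynomial.map (algebraMap A O) f := fun _ => rfl
  -- `T'` over `O[X]`: `X ↦ t⁻¹/1`, constants through `ℓ`
  let ψ : O[X] →+* T' := eval₂RingHom ℓ (algebraMap F.extendedRees T' t)
  letI algOT : Algebra O[X] T' := ψ.toAlgebra
  have hψ : ∀ g : O[X], algebraMap O[X] T' g = eval₂ ℓ (algebraMap F.extendedRees T' t) g := fun _ => rfl
  haveI : IsScalarTower A[X] O[X] T' := by
    refine IsScalarTower.of_algebraMap_eq fun f => ?_
    rw [halgT, hψ, halgO, eval₂_map]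
    change algebraMap F.extendedRees T' (eval₂ (algebraMap A F.extendedRees) t f) = _
    rw [hom_eval₂]
    congr 1
    ext a
    exact (hℓ a).symm
  -- `A ∖ p ⊆ A[X] ∖ 𝔔`
  have hMN : p.primeCompl.map (C : A →+* A[X]) ≤ 𝔔.primeCompl := by
    rintro _ ⟨a, ha, rfl⟩
    intro haQ
    apply ha
    have h1 : aeval t (C a) ∈ Q := (hmem𝔔 _).mp haQ
    rw [aeval_C] at h1
    rw [← hp]
    exact h1
  haveI hT' : IsLocalization (𝔔.primeCompl.map (algebraMap A[X] O[X])) T' :=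
    IsLocalization.isLocalization_of_submonoid_le (S := O[X]) (T := T') _ _ hMN
  -- the prime `𝔮 = 𝔔 O[X]`
  have hdisj : Disjoint ((p.primeCompl.map (C : A →+* A[X]) : Submonoid A[X]) : Set A[X]) (𝔔 : Set A[X]) := by
    rw [Set.disjoint_left]
    intro f hf hfQ
    exact hMN hf hfQ
  let 𝔮 : Ideal O[X] := 𝔔.map (algebraMap A[X] O[X])
  haveI h𝔮 : 𝔮.IsPrime := IsLocalization.isPrime_of_isPrime_disjoint _ O[X] 𝔔 h𝔔p hdisj
  have h𝔮𝔔 : 𝔮.comap (algebraMap A[X] O[X]) = 𝔔 := IsLocalization.under_map_of_isPrime_disjoint _ O[X] h𝔔p hdisj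
  -- `T'` is the localisation of `O[X]` at `𝔮`
  haveI hT𝔮 : IsLocalization.AtPrime T' 𝔮 := by
    refine IsLocalization.of_le (𝔔.primeCompl.map (algebraMap A[X] O[X])) 𝔮.primeCompl ?_ ?_
    · rintro _ ⟨f, hf, rfl⟩
      intro hf𝔮
      apply hf
      rw [← h𝔮𝔔]
      exact hf𝔮
    · intro z hz
      obtain ⟨⟨f, ⟨m, hm⟩⟩, hzf⟩ := IsLocalization.surj (p.primeCompl.map (C : A →+* A[X])) z
      simp only at hzf
      have hmQ : m ∉ 𝔔 := hMN hm
      have hf𝔔 : f ∉ 𝔔 := by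
        intro hf
        have h1 : z * algebraMap A[X] O[X] m ∈ 𝔮 := by
          rw [hzf]; exact Ideal.mem_map_of_mem _ hf
        rcases h𝔮.mem_or_mem h1 with h2 | h2
        · exact hz h2
        · apply hmQ
          rw [← h𝔮𝔔]
          exact h2
      have hu : IsUnit (algebraMap A[X] T' f) := IsLocalization.map_units T' (⟨f, hf𝔔⟩ : 𝔔.primeCompl)
      have h3 : algebraMap O[X] T' z * algebraMap A[X] T' m = algebraMap A[X] T' f := by
        rw [IsScalarTower.algebraMap_apply A[X] O[X] T' m, ← map_mul, hzf,
          ← IsScalarTower.algebraMap_apply A[X] O[X] T' f]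
      exact isUnit_of_mul_isUnit_left (h3 ▸ hu)
  -- the model isomorphism
  let e : Localization.AtPrime 𝔮 ≃+* T' :=
    (IsLocalization.algEquiv 𝔮.primeCompl (Localization.AtPrime 𝔮) T').toRingEquiv
  have he : ∀ g : O[X], e (algebraMap O[X] (Localization.AtPrime 𝔮) g) = algebraMap O[X] T' g :=
    fun g => (IsLocalization.algEquiv 𝔮.primeCompl (Localization.AtPrime 𝔮) T').commutes g
  refine ⟨𝔮, h𝔮, ?_, e, fun s => ?_⟩
  · -- `𝔮 ∩ O = 𝔪_O`
    have hle : maximalIdeal O ≤ 𝔮.comap (C : O →+* O[X]) := by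
      rw [← IsLocalization.AtPrime.map_eq_maximalIdeal p O, Ideal.map_le_iff_le_comap]
      intro a ha
      rw [Ideal.mem_comap, Ideal.mem_comap]
      have h1 : (C (algebraMap A O a) : O[X]) = algebraMap A[X] O[X] (C a) := by
        rw [halgO, Polynomial.map_C]
      rw [h1]
      refine Ideal.mem_map_of_mem _ ((hmem𝔔 _).mpr ?_)
      rw [aeval_C]
      have ha' : a ∈ Q.comap (algebraMap A F.extendedRees) := by rw [hp]; exact ha
      exact ha'
    have hne : 𝔮.comap (C : O →+* O[X]) ≠ ⊤ := Ideal.comap_ne_top _ h𝔮.ne_top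
    exact ((IsLocalRing.maximalIdeal.isMaximal O).eq_of_le hne hle).symm
  · rw [he, hψ, Polynomial.eval₂_C]

end ExtendedRees

end Summit.ResolutionOfSingularities.ResolutionOfSingularities.Theorems.ELadderOne.TrivialEnd

end
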